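import Summits.Ventures.CertifiedArithmetic.Expansions.IncircleStageCTerms
import Summits.Ventures.CertifiedArithmetic.Expansions.IncircleStageCSum
import Summits.Ventures.CertifiedArithmetic.Expansions.IncircleStageBBounds
import Mathlib.Tactic.Linarith
import Mathlib.Tactic.Positivity
import Mathlib.Tactic.Ring
import Mathlib.Tactic.NormNum

/-!
# INCIRCLE, stage C, part 3: the sign test is sound under two explicit margins

Shared numerical engines serving client cells; rigour lives in the verifiers; every published number
belongs to a client cell's ledger, not to the engines group.  NEW WORK (see part 1,
`IncircleStageCTerms`, for the object and the honest framing: our transcription of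
`incircleadapt`'s stage C as hypotheses between rationals; nothing is claimed about the C code
itself).

THE OBJECT.  After stage B, `incircleadapt` computes the tails of the six differences, returns the
stage-B value `det_B` if they all vanish, and otherwise sets `errbound = (K_C ⊗ permanent) ⊕
(K_R ⊗ |det_B|)`, `det_C = det_B ⊕ c` with `c = (t_a ⊕ t_b) ⊕ t_c` the floating-point evaluation of
the first-order correction (one cyclic term `t_z = (L_z ⊗ d_z) ⊕ ((2 g_z) ⊗ (P ⊖ P'))`, part 1), and
returns `det_C` if `|det_C| ≥ errbound`.  In `predicates.c`, `K_C = iccerrboundC = (44 + 576ε)ε²`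
and `K_R = resulterrbound = (3 + 8ε)ε`.  The lifts `L_z = (x ⊗ x) ⊕ (y ⊗ y)` of the correction are
the computed lifts of stage A (same expression, same rounding), which also enter `permanent`.

THE RESULT.  `incircle_stageC_sign_of_bounds`: for ANY constants `K_C`, `K_R` and any estimate
error `δ` (`|det_B − B| ≤ δ|B|`, `B` the incircle determinant of the rounded differences)
satisfying
  (MC) `40ε² + 166ε³ + 335ε⁴ + 429ε⁵ + 375ε⁶ + 225ε⁷ + 88ε⁸ + 20ε⁹ + 2ε¹⁰ < (1 − ε)⁷ K_C` and
  (MR) `δ < (1 − δ)(1 − ε)³ K_R`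
(`0 < ε ≤ 1/2`, `0 ≤ δ < 1`), a passed test forces `det_C ≠ 0` with the sign of the true
determinant `T` over the exact differences `x + xt`, in both directions.  The proof: `T = B + Lin +
R` with `Lin` the first-order terms and `R` the remainders (part 2, with `Λ_z = (1 + ε)²L_z ≥ x² +
y²`, `sumSq_le_of_rel`); `|det_C − T| ≤ ε|det_C| + δ|B| + |c − Lin| + |R| ≤ ε|det_C| + δ|B| +
κ_B(ε)Π'`, `Π' = Σ_z L_z(|P| + |P'|)`, where `|c − Lin| ≤ (34ε² + 144ε³ + 304ε⁴ + 408ε⁵ + 368ε⁶ +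
224ε⁷ + 88ε⁸ + 20ε⁹ + 2ε¹⁰)Π'` (parts 1 and 2: `e + (2ε + ε²)M` for the term polynomials `e`, `M`)
and `|R| ≤ (6ε² + 4ε³ + ε⁴)(1 + ε)³Π'`, so `κ_B = 40ε² + 166ε³ + … + 2ε¹⁰`; on the other side
`incirclePermanent_ge` (stage B) gives `K_C ⊗ W ≥ (1 − ε)⁵K_C Π'`, hence `E ≥ (1 − ε)((1 − ε)⁵K_C Π'
+ (1 − ε)K_R|det_B|)` and `(1 − δ)|B| ≤ |det_B|`; the margins turn `δ|B| + κ_B Π'` into strictly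
less than `(1 − ε)E ≤ (1 − ε)|det_C|` unless `Π' = 0`, in which case everything including `det_C`
and `T` vanishes.  (MR) is literally the margin of ORIENT3D's stage C (`Orient3dStageCBounds`).

THE FINDING (the margins are evaluated in part 4, `IncircleStageCMargins`, and in
`Orient3dStageCMargins`; recorded, not adjudicated).  (MC) holds for Shewchuk's `K_C = (44 +
576ε)ε²` when `p ≥ 5` and FAILS at `p = 4` (margin `ε²(4 + 102ε − 3443ε² + …)`, `≈ −0.87ε²` at `ε =
1/16`).  (MR) hinges on the estimate error `δ`: the paper (§2.7) asserts that `estimate` errs by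
less than one ulp, which is false for general nonoverlapping expansions (`Orient2dEstimate`); the
bound this development works with for the weakly nonoverlapping expansions of stage B is `δ = 3ε`
(cf. `EstimateWeakExpansion`).  With `δ = 3ε`, (MR) FAILS for Shewchuk's `K_R = (3 + 8ε)ε` at
every precision `p ≥ 2` and holds for `K_R = (3 + 24ε)ε` when `p ≥ 4`; with `δ = 2ε` it holds for
`(3 + 8ε)ε` from `p ≥ 3`.  So the pair certified here under `δ = 3ε` is `((44 + 576ε)ε²,
(3 + 24ε)ε)` for `p ≥ 5`.  A failed margin is a gap in a sufficient condition of OUR analysis: it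
exhibits no input on which `predicates.c` errs, and we know of none.

Evidence gathered before typing (engines; not verification): in the exact rational model of parts
1–2 (`p ∈ {4, 5, 8}`, 600 quadruples each, 347 / 381 / 192 with a nonzero tail) every component
inequality held with room (worst observed: term `4.2ε²` of the proved `26ε²`, sum `2.1ε²` of
`34ε²`, remainder `2.7ε²` of `≥ 6ε²`, all relative to their scales), and the end-to-end test with
`(K_C, K_R) = ((44 + 576ε)ε², (3 + 8ε)ε)` answered 47 / 115 / 161 times with no wrong sign, with
`(3 + 24ε)ε` 43 / 114 / 161 times, no wrong sign; a control with both constants divided by 8 also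
produced no wrong sign (145 / 185 / 181 answers) — random sampling does not probe these margins;
the distinction between the constants is the analysis, not the experiment.
References: J. R. Shewchuk, Discrete Comput. Geom. 18 (1997) 305–363, §4.4, Table 5, and
`predicates.c` (`incircleadapt`) [Shewchuk1997].
-/

namespace Summit.Ventures.CertifiedArithmetic.Expansions

/-- From `|a − r| ≤ u|a|` and `0 ≤ a`: `(1 − u)a ≤ r`. -/
private theorem lower_of_rel' {u a r : ℚ} (h : |a - r| ≤ u * |a|) (ha : 0 ≤ a) :
    (1 - u) * a ≤ r := by
  rw [abs_of_nonneg ha] at h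
  have := (abs_sub_le_iff.mp h).1
  linarith

/-- The computed error bound `E = E₁ ⊕ (K_R ⊗ |d_B|)` from below, given `E₁ ≥ X ≥ 0`. -/
private theorem errC_ge' {u X KR dB E₁ E₂ E : ℚ} (hu1 : u ≤ 1) (hX0 : 0 ≤ X) (hKR : 0 ≤ KR)
    (h1 : X ≤ E₁) (hE₂ : |(KR * |dB|) - E₂| ≤ u * |(KR * |dB|)|)
    (hE : |(E₁ + E₂) - E| ≤ u * |E₁ + E₂|) :
    (1 - u) * X + (1 - u) ^ 2 * (KR * |dB|) ≤ E := by
  have h1u : 0 ≤ 1 - u := by linarith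
  have h2 : (1 - u) * (KR * |dB|) ≤ E₂ := lower_of_rel' hE₂ (by positivity)
  have h10 : 0 ≤ E₁ := hX0.trans h1
  have h20 : 0 ≤ E₂ := le_trans (by positivity) h2
  have h3 : (1 - u) * (E₁ + E₂) ≤ E := lower_of_rel' hE (by linarith)
  have h4 := mul_le_mul_of_nonneg_left (add_le_add h1 h2) h1u
  nlinarith

/-- Triangle inequality along an identity `x = a + b + c`. -/
private theorem abs_le_of_eq_add3' {x a b c ka kb kc : ℚ} (h : x = a + b + c) (ha : |a| ≤ ka)
    (hb : |b| ≤ kb) (hc : |c| ≤ kc) : |x| ≤ ka + kb + kc := by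
  rw [h]
  have a1 := abs_add_le (a + b) c
  have a2 := abs_add_le a b
  linarith

/-- The zeroth-order part of one cyclic term against a bound `Λ` of the exact lift and the
computed products. -/
private theorem abs_lminor_le {u ℓ Λ x₁ y₁ x₂ y₂ P Q : ℚ} (hℓ0 : 0 ≤ ℓ) (hℓ : ℓ ≤ Λ)
    (hP : |x₁ * y₁ - P| ≤ u * |P|) (hQ : |x₂ * y₂ - Q| ≤ u * |Q|) :
    |ℓ * (x₁ * y₁ - x₂ * y₂)| ≤ (1 + u) * (Λ * (|P| + |Q|)) := by
  have hP' : |x₁ * y₁| ≤ (1 + u) * |P| := by linarith [abs_sub_abs_le_abs_sub (x₁ * y₁) P]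
  have hQ' : |x₂ * y₂| ≤ (1 + u) * |Q| := by linarith [abs_sub_abs_le_abs_sub (x₂ * y₂) Q]
  rw [abs_mul, abs_of_nonneg hℓ0]
  have h := abs_sub (x₁ * y₁) (x₂ * y₂)
  have hm : |x₁ * y₁ - x₂ * y₂| ≤ (1 + u) * (|P| + |Q|) := by linarith
  have := mul_le_mul hℓ hm (abs_nonneg _) (hℓ0.trans hℓ)
  linarith

/-- Sign transfer: `|a − b| < |a|` forces `b` to have the (strict) sign of `a`, both ways. -/
private theorem sign_iff_of_abs_sub_lt' {a b : ℚ} (h : |a - b| < |a|) :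
    (0 < a ↔ 0 < b) ∧ (a < 0 ↔ b < 0) := by
  rcases lt_trichotomy a 0 with ha | ha | ha
  · rw [abs_of_neg ha] at h
    have h' := abs_lt.mp h
    refine ⟨⟨fun h2 => by linarith, fun h2 => by linarith [h'.1]⟩,
      ⟨fun _ => by linarith [h'.1], fun _ => ha⟩⟩
  · subst ha
    have : (0 : ℚ) < 0 := lt_of_le_of_lt (abs_nonneg (0 - b)) (by simpa using h)
    exact absurd this (lt_irrefl 0)
  · rw [abs_of_pos ha] at h
    have h' := abs_lt.mp h
    refine ⟨⟨fun _ => by linarith [h'.2], fun _ => ha⟩,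
      ⟨fun h2 => by linarith, fun h2 => by linarith [h'.2]⟩⟩

/-! ## Stage C is sound, as an inequality between rationals -/

/-- **The sign test of INCIRCLE's stage C is sound, as an inequality between rationals, for any
constants `K_C`, `K_R` and estimate error `δ` satisfying the two margins**
`40ε² + 166ε³ + 335ε⁴ + 429ε⁵ + 375ε⁶ + 225ε⁷ + 88ε⁸ + 20ε⁹ + 2ε¹⁰ < (1 − ε)⁷K_C` and
`δ < (1 − δ)(1 − ε)³K_R` (`0 < ε ≤ 1/2`, `0 ≤ δ < 1`).  Data (see the module docstring): the six
computed differences and their tails (`|tail| ≤ ε|difference|`); the six products, six squares and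
three lifts of stage A in the stage-B form (`IncircleStageBBounds`); per cyclic term the 14
roundings of part 1 (`incircleCTerm_sub_le`) and the 2 of the sum `c`; the permanent chain of
`incirclePermanent_ge` up to `E₁ = K_C ⊗ W`; the stage-B value `d_B` with `|d_B − B| ≤ δ|B|`; the
returned value `d_C = d_B ⊕ c` (`|d_C − (d_B + c)| ≤ ε|d_C|`); the error bound `E = E₁ ⊕ (K_R ⊗
|d_B|)` and the passed test `E ≤ |d_C|`.  Then `d_C` is nonzero exactly with the sign of the true
incircle determinant `T` (over the differences `x + tail`), both ways. -/
theorem incircle_stageC_sign_of_bounds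
    {u δ KC KR xa₁ xa₂ xb₁ xb₂ xc₁ xc₂ xa₁t xa₂t xb₁t xb₂t xc₁t xc₂t P₁ P₂ P₃ P₄ P₅ P₆
      Sa₁ Sa₂ Sb₁ Sb₂ Sc₁ Sc₂ La Lb Lc pa₁ pa₂ pa₃ pa₄ sa₁ sa₂ ra ga₁ ga₂ ga ma ea na ta
      pb₁ pb₂ pb₃ pb₄ sb₁ sb₂ rb gb₁ gb₂ gb mb eb nb tb
      pc₁ pc₂ pc₃ pc₄ sc₁ sc₂ rc gc₁ gc₂ gc mc ec nc tc
      c₁ c Aa Ab Ac αa αb αc W₁ W dB dC E₁ E₂ E : ℚ}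
    (hu0 : 0 < u) (hu1 : u ≤ 1 / 2) (hδ0 : 0 ≤ δ) (hδ1 : δ < 1)
    (hmarginC : 40 * u ^ 2 + 166 * u ^ 3 + 335 * u ^ 4 + 429 * u ^ 5 + 375 * u ^ 6
      + 225 * u ^ 7 + 88 * u ^ 8 + 20 * u ^ 9 + 2 * u ^ 10 < (1 - u) ^ 7 * KC)
    (hmarginR : δ < (1 - δ) * ((1 - u) ^ 3 * KR))
    -- tails of the differences
    (hxa₁t : |xa₁t| ≤ u * |xa₁|) (hxa₂t : |xa₂t| ≤ u * |xa₂|) (hxb₁t : |xb₁t| ≤ u * |xb₁|)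
    (hxb₂t : |xb₂t| ≤ u * |xb₂|) (hxc₁t : |xc₁t| ≤ u * |xc₁|) (hxc₂t : |xc₂t| ≤ u * |xc₂|)
    -- the stage-A products, squares and lifts, as in stage B
    (hP₁ : |xb₁ * xc₂ - P₁| ≤ u * |P₁|) (hP₂ : |xc₁ * xb₂ - P₂| ≤ u * |P₂|)
    (hP₃ : |xc₁ * xa₂ - P₃| ≤ u * |P₃|) (hP₄ : |xa₁ * xc₂ - P₄| ≤ u * |P₄|)
    (hP₅ : |xa₁ * xb₂ - P₅| ≤ u * |P₅|) (hP₆ : |xb₁ * xa₂ - P₆| ≤ u * |P₆|)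
    (hSa₁ : |xa₁ * xa₁ - Sa₁| ≤ u * |Sa₁|) (hSa₂ : |xa₂ * xa₂ - Sa₂| ≤ u * |Sa₂|)
    (hSb₁ : |xb₁ * xb₁ - Sb₁| ≤ u * |Sb₁|) (hSb₂ : |xb₂ * xb₂ - Sb₂| ≤ u * |Sb₂|)
    (hSc₁ : |xc₁ * xc₁ - Sc₁| ≤ u * |Sc₁|) (hSc₂ : |xc₂ * xc₂ - Sc₂| ≤ u * |Sc₂|)
    (hSa₁0 : 0 ≤ Sa₁) (hSa₂0 : 0 ≤ Sa₂) (hSb₁0 : 0 ≤ Sb₁) (hSb₂0 : 0 ≤ Sb₂)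
    (hSc₁0 : 0 ≤ Sc₁) (hSc₂0 : 0 ≤ Sc₂)
    (hLa : |(Sa₁ + Sa₂) - La| ≤ u * |La|) (hLb : |(Sb₁ + Sb₂) - Lb| ≤ u * |Lb|)
    (hLc : |(Sc₁ + Sc₂) - Lc| ≤ u * |Lc|) (hLa0 : 0 ≤ La) (hLb0 : 0 ≤ Lb) (hLc0 : 0 ≤ Lc)
    -- term a: lift of a, cofactor (b, c)
    (hpa₁ : |xb₁ * xc₂t - pa₁| ≤ u * |xb₁ * xc₂t|) (hpa₂ : |xc₂ * xb₁t - pa₂| ≤ u * |xc₂ * xb₁t|)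
    (hpa₃ : |xb₂ * xc₁t - pa₃| ≤ u * |xb₂ * xc₁t|) (hpa₄ : |xc₁ * xb₂t - pa₄| ≤ u * |xc₁ * xb₂t|)
    (hsa₁ : |(pa₁ + pa₂) - sa₁| ≤ u * |pa₁ + pa₂|) (hsa₂ : |(pa₃ + pa₄) - sa₂| ≤ u * |pa₃ + pa₄|)
    (hra : |(sa₁ - sa₂) - ra| ≤ u * |sa₁ - sa₂|) (hga₁ : |xa₁ * xa₁t - ga₁| ≤ u * |xa₁ * xa₁t|)
    (hga₂ : |xa₂ * xa₂t - ga₂| ≤ u * |xa₂ * xa₂t|) (hga : |(ga₁ + ga₂) - ga| ≤ u * |ga₁ + ga₂|)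
    (hma : |La * ra - ma| ≤ u * |La * ra|) (hea : |(P₁ - P₂) - ea| ≤ u * |P₁ - P₂|)
    (hna : |(2 * ga) * ea - na| ≤ u * |(2 * ga) * ea|) (hta : |(ma + na) - ta| ≤ u * |ma + na|)
    -- term b: lift of b, cofactor (c, a)
    (hpb₁ : |xc₁ * xa₂t - pb₁| ≤ u * |xc₁ * xa₂t|) (hpb₂ : |xa₂ * xc₁t - pb₂| ≤ u * |xa₂ * xc₁t|)
    (hpb₃ : |xc₂ * xa₁t - pb₃| ≤ u * |xc₂ * xa₁t|) (hpb₄ : |xa₁ * xc₂t - pb₄| ≤ u * |xa₁ * xc₂t|)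
    (hsb₁ : |(pb₁ + pb₂) - sb₁| ≤ u * |pb₁ + pb₂|) (hsb₂ : |(pb₃ + pb₄) - sb₂| ≤ u * |pb₃ + pb₄|)
    (hrb : |(sb₁ - sb₂) - rb| ≤ u * |sb₁ - sb₂|) (hgb₁ : |xb₁ * xb₁t - gb₁| ≤ u * |xb₁ * xb₁t|)
    (hgb₂ : |xb₂ * xb₂t - gb₂| ≤ u * |xb₂ * xb₂t|) (hgb : |(gb₁ + gb₂) - gb| ≤ u * |gb₁ + gb₂|)
    (hmb : |Lb * rb - mb| ≤ u * |Lb * rb|) (heb : |(P₃ - P₄) - eb| ≤ u * |P₃ - P₄|)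
    (hnb : |(2 * gb) * eb - nb| ≤ u * |(2 * gb) * eb|) (htb : |(mb + nb) - tb| ≤ u * |mb + nb|)
    -- term c: lift of c, cofactor (a, b)
    (hpc₁ : |xa₁ * xb₂t - pc₁| ≤ u * |xa₁ * xb₂t|) (hpc₂ : |xb₂ * xa₁t - pc₂| ≤ u * |xb₂ * xa₁t|)
    (hpc₃ : |xa₂ * xb₁t - pc₃| ≤ u * |xa₂ * xb₁t|) (hpc₄ : |xb₁ * xa₂t - pc₄| ≤ u * |xb₁ * xa₂t|)
    (hsc₁ : |(pc₁ + pc₂) - sc₁| ≤ u * |pc₁ + pc₂|) (hsc₂ : |(pc₃ + pc₄) - sc₂| ≤ u * |pc₃ + pc₄|)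
    (hrc : |(sc₁ - sc₂) - rc| ≤ u * |sc₁ - sc₂|) (hgc₁ : |xc₁ * xc₁t - gc₁| ≤ u * |xc₁ * xc₁t|)
    (hgc₂ : |xc₂ * xc₂t - gc₂| ≤ u * |xc₂ * xc₂t|) (hgc : |(gc₁ + gc₂) - gc| ≤ u * |gc₁ + gc₂|)
    (hmc : |Lc * rc - mc| ≤ u * |Lc * rc|) (hec : |(P₅ - P₆) - ec| ≤ u * |P₅ - P₆|)
    (hnc : |(2 * gc) * ec - nc| ≤ u * |(2 * gc) * ec|) (htc : |(mc + nc) - tc| ≤ u * |mc + nc|)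
    -- the sum of the three terms
    (hc₁ : |(ta + tb) - c₁| ≤ u * |ta + tb|) (hc : |(c₁ + tc) - c| ≤ u * |c₁ + tc|)
    -- the permanent (stage A) up to `E₁ = K_C ⊗ W`
    (hAa : |(|P₁| + |P₂|) - Aa| ≤ u * |(|P₁| + |P₂|)|)
    (hAb : |(|P₃| + |P₄|) - Ab| ≤ u * |(|P₃| + |P₄|)|)
    (hAc : |(|P₅| + |P₆|) - Ac| ≤ u * |(|P₅| + |P₆|)|)
    (hαa : |Aa * La - αa| ≤ u * |Aa * La|) (hαb : |Ab * Lb - αb| ≤ u * |Ab * Lb|)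
    (hαc : |Ac * Lc - αc| ≤ u * |Ac * Lc|) (hW₁ : |(αa + αb) - W₁| ≤ u * |αa + αb|)
    (hW : |(W₁ + αc) - W| ≤ u * |W₁ + αc|) (hE₁ : |KC * W - E₁| ≤ u * |KC * W|)
    -- the stage-B estimate, the returned value, the error bound, the test
    (hdB : |dB - ((xa₁ * xa₁ + xa₂ * xa₂) * (xb₁ * xc₂ - xc₁ * xb₂)
        + (xb₁ * xb₁ + xb₂ * xb₂) * (xc₁ * xa₂ - xa₁ * xc₂)
        + (xc₁ * xc₁ + xc₂ * xc₂) * (xa₁ * xb₂ - xb₁ * xa₂))|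
      ≤ δ * |(xa₁ * xa₁ + xa₂ * xa₂) * (xb₁ * xc₂ - xc₁ * xb₂)
        + (xb₁ * xb₁ + xb₂ * xb₂) * (xc₁ * xa₂ - xa₁ * xc₂)
        + (xc₁ * xc₁ + xc₂ * xc₂) * (xa₁ * xb₂ - xb₁ * xa₂)|)
    (hdC : |dC - (dB + c)| ≤ u * |dC|) (hE₂ : |(KR * |dB|) - E₂| ≤ u * |(KR * |dB|)|)
    (hE : |(E₁ + E₂) - E| ≤ u * |E₁ + E₂|) (htest : E ≤ |dC|) :
    (0 < dC ↔ 0 < ((xa₁ + xa₁t) * (xa₁ + xa₁t) + (xa₂ + xa₂t) * (xa₂ + xa₂t))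
          * ((xb₁ + xb₁t) * (xc₂ + xc₂t) - (xc₁ + xc₁t) * (xb₂ + xb₂t))
        + ((xb₁ + xb₁t) * (xb₁ + xb₁t) + (xb₂ + xb₂t) * (xb₂ + xb₂t))
          * ((xc₁ + xc₁t) * (xa₂ + xa₂t) - (xa₁ + xa₁t) * (xc₂ + xc₂t))
        + ((xc₁ + xc₁t) * (xc₁ + xc₁t) + (xc₂ + xc₂t) * (xc₂ + xc₂t))
          * ((xa₁ + xa₁t) * (xb₂ + xb₂t) - (xb₁ + xb₁t) * (xa₂ + xa₂t))) ∧
      (dC < 0 ↔ ((xa₁ + xa₁t) * (xa₁ + xa₁t) + (xa₂ + xa₂t) * (xa₂ + xa₂t))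
          * ((xb₁ + xb₁t) * (xc₂ + xc₂t) - (xc₁ + xc₁t) * (xb₂ + xb₂t))
        + ((xb₁ + xb₁t) * (xb₁ + xb₁t) + (xb₂ + xb₂t) * (xb₂ + xb₂t))
          * ((xc₁ + xc₁t) * (xa₂ + xa₂t) - (xa₁ + xa₁t) * (xc₂ + xc₂t))
        + ((xc₁ + xc₁t) * (xc₁ + xc₁t) + (xc₂ + xc₂t) * (xc₂ + xc₂t))
          * ((xa₁ + xa₁t) * (xb₂ + xb₂t) - (xb₁ + xb₁t) * (xa₂ + xa₂t)) < 0) := by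
  have hu := hu0.le
  have h1u : 0 < 1 - u := by linarith only [hu1]
  -- the products in the operand order of the correction terms
  have hP₂' : |xb₂ * xc₁ - P₂| ≤ u * |P₂| := by rw [mul_comm]; exact hP₂
  have hP₄' : |xc₂ * xa₁ - P₄| ≤ u * |P₄| := by rw [mul_comm]; exact hP₄
  have hP₆' : |xa₂ * xb₁ - P₆| ≤ u * |P₆| := by rw [mul_comm]; exact hP₆
  -- the computed lifts against the exact lifts of the computed differences
  have lEa := sumSq_sub_lift_le hu hSa₁ hSa₂ hSa₁0 hSa₂0 hLa hLa0
  have lEb := sumSq_sub_lift_le hu hSb₁ hSb₂ hSb₁0 hSb₂0 hLb hLb0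
  have lEc := sumSq_sub_lift_le hu hSc₁ hSc₂ hSc₁0 hSc₂0 hLc hLc0
  have lMa := sumSq_le_of_rel hu hSa₁ hSa₂ hSa₁0 hSa₂0 hLa hLa0
  have lMb := sumSq_le_of_rel hu hSb₁ hSb₂ hSb₁0 hSb₂0 hLb hLb0
  have lMc := sumSq_le_of_rel hu hSc₁ hSc₂ hSc₁0 hSc₂0 hLc hLc0
  -- the three computed terms, their sum, the three remainders, the zeroth-order parts
  obtain ⟨eTa, mTa⟩ := incircleCTerm_sub_le hu hxa₁t hxa₂t hLa0 lEa lMa hxb₁t hxc₂t hxb₂t hxc₁t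
    hP₁ hP₂' hpa₁ hpa₂ hpa₃ hpa₄ hsa₁ hsa₂ hra hga₁ hga₂ hga hma hea hna hta
  obtain ⟨eTb, mTb⟩ := incircleCTerm_sub_le hu hxb₁t hxb₂t hLb0 lEb lMb hxc₁t hxa₂t hxc₂t hxa₁t
    hP₃ hP₄' hpb₁ hpb₂ hpb₃ hpb₄ hsb₁ hsb₂ hrb hgb₁ hgb₂ hgb hmb heb hnb htb
  obtain ⟨eTc, mTc⟩ := incircleCTerm_sub_le hu hxc₁t hxc₂t hLc0 lEc lMc hxa₁t hxb₂t hxa₂t hxb₁t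
    hP₅ hP₆' hpc₁ hpc₂ hpc₃ hpc₄ hsc₁ hsc₂ hrc hgc₁ hgc₂ hgc hmc hec hnc htc
  obtain ⟨eL, mL⟩ := roundedSum3_sub_le hu eTa mTa eTb mTb eTc mTc hc₁ hc
  have rA := incircleCRemainder_le hu hxa₁t hxa₂t lMa hxb₁t hxc₂t hxb₂t hxc₁t hP₁ hP₂'
  have rB := incircleCRemainder_le hu hxb₁t hxb₂t lMb hxc₁t hxa₂t hxc₂t hxa₁t hP₃ hP₄'
  have rC := incircleCRemainder_le hu hxc₁t hxc₂t lMc hxa₁t hxb₂t hxa₂t hxb₁t hP₅ hP₆'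
  have bA := abs_lminor_le (add_nonneg (mul_self_nonneg xa₁) (mul_self_nonneg xa₂)) lMa hP₁ hP₂'
  have bB := abs_lminor_le (add_nonneg (mul_self_nonneg xb₁) (mul_self_nonneg xb₂)) lMb hP₃ hP₄'
  have bC := abs_lminor_le (add_nonneg (mul_self_nonneg xc₁) (mul_self_nonneg xc₂)) lMc hP₅ hP₆'
  -- names
  set Pi := La * (|P₁| + |P₂|) + Lb * (|P₃| + |P₄|) + Lc * (|P₅| + |P₆|) with hPi
  set B := (xa₁ * xa₁ + xa₂ * xa₂) * (xb₁ * xc₂ - xc₁ * xb₂)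
        + (xb₁ * xb₁ + xb₂ * xb₂) * (xc₁ * xa₂ - xa₁ * xc₂)
        + (xc₁ * xc₁ + xc₂ * xc₂) * (xa₁ * xb₂ - xb₁ * xa₂) with hB
  set T := ((xa₁ + xa₁t) * (xa₁ + xa₁t) + (xa₂ + xa₂t) * (xa₂ + xa₂t))
          * ((xb₁ + xb₁t) * (xc₂ + xc₂t) - (xc₁ + xc₁t) * (xb₂ + xb₂t))
        + ((xb₁ + xb₁t) * (xb₁ + xb₁t) + (xb₂ + xb₂t) * (xb₂ + xb₂t))
          * ((xc₁ + xc₁t) * (xa₂ + xa₂t) - (xa₁ + xa₁t) * (xc₂ + xc₂t))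
        + ((xc₁ + xc₁t) * (xc₁ + xc₁t) + (xc₂ + xc₂t) * (xc₂ + xc₂t))
          * ((xa₁ + xa₁t) * (xb₂ + xb₂t) - (xb₁ + xb₁t) * (xa₂ + xa₂t)) with hT
  set Lin := ((xa₁ * xa₁ + xa₂ * xa₂) * ((xb₁ * xc₂t + xc₂ * xb₁t) - (xb₂ * xc₁t + xc₁ * xb₂t))
          + 2 * (xa₁ * xa₁t + xa₂ * xa₂t) * (xb₁ * xc₂ - xb₂ * xc₁))
        + ((xb₁ * xb₁ + xb₂ * xb₂) * ((xc₁ * xa₂t + xa₂ * xc₁t) - (xc₂ * xa₁t + xa₁ * xc₂t))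
          + 2 * (xb₁ * xb₁t + xb₂ * xb₂t) * (xc₁ * xa₂ - xc₂ * xa₁))
        + ((xc₁ * xc₁ + xc₂ * xc₂) * ((xa₁ * xb₂t + xb₂ * xa₁t) - (xa₂ * xb₁t + xb₁ * xa₂t))
          + 2 * (xc₁ * xc₁t + xc₂ * xc₂t) * (xa₁ * xb₂ - xa₂ * xb₁)) with hLin
  have hPi0 : 0 ≤ Pi := by
    rw [hPi]
    exact add_nonneg (add_nonneg (mul_nonneg hLa0 (by positivity))
      (mul_nonneg hLb0 (by positivity))) (mul_nonneg hLc0 (by positivity))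
  -- the constants are positive
  have hKC : 0 < KC := by
    have h : 0 < (1 - u) ^ 7 * KC := lt_of_le_of_lt (by positivity) hmarginC
    exact pos_of_mul_pos_right h (pow_nonneg h1u.le 7)
  have hKR : 0 < KR := by
    have h1 : 0 < (1 - δ) * ((1 - u) ^ 3 * KR) := lt_of_le_of_lt hδ0 hmarginR
    have h2 := pos_of_mul_pos_right h1 (by linarith only [hδ1] : 0 ≤ 1 - δ)
    exact pos_of_mul_pos_right h2 (pow_nonneg h1u.le 3)
  -- the permanent and the error bound, from below
  have hW5 := incirclePermanent_ge hu (by linarith only [hu1]) hKC.le (by positivity)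
    (by positivity) (by positivity) hLa0 hLb0 hLc0 hAa hAb hAc hαa hαb hαc hW₁ hW hE₁
  have hX0 : 0 ≤ (1 - u) ^ 5 * KC * Pi := by positivity
  have hEge := errC_ge' (by linarith only [hu1]) hX0 hKR.le hW5 hE₂ hE
  -- |B|, |T − B − Lin| and |Lin| against Π'
  have hBle : |B| ≤ (1 + u) ^ 3 * Pi := by
    have h := abs_le_of_eq_add3' (x := B) (by rw [hB]; ring) bA bB bC
    have e : (1 + u) ^ 3 * Pi = (1 + u) * (((1 + u) ^ 2 * La) * (|P₁| + |P₂|))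
        + (1 + u) * (((1 + u) ^ 2 * Lb) * (|P₃| + |P₄|))
        + (1 + u) * (((1 + u) ^ 2 * Lc) * (|P₅| + |P₆|)) := by
      rw [hPi]; ring
    linarith only [h, e]
  have hRle : |T - B - Lin| ≤ (6 * u ^ 2 + 4 * u ^ 3 + u ^ 4) * (1 + u) ^ 3 * Pi := by
    have h := abs_le_of_eq_add3' (x := T - B - Lin) (by rw [hT, hB, hLin]; ring) rA rB rC
    have e : (6 * u ^ 2 + 4 * u ^ 3 + u ^ 4) * (1 + u) ^ 3 * Pi
        = (6 * u ^ 2 + 4 * u ^ 3 + u ^ 4) * (1 + u) * (((1 + u) ^ 2 * La) * (|P₁| + |P₂|))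
        + (6 * u ^ 2 + 4 * u ^ 3 + u ^ 4) * (1 + u) * (((1 + u) ^ 2 * Lb) * (|P₃| + |P₄|))
        + (6 * u ^ 2 + 4 * u ^ 3 + u ^ 4) * (1 + u) * (((1 + u) ^ 2 * Lc) * (|P₅| + |P₆|)) := by
      rw [hPi]; ring
    linarith only [h, e]
  have eL' : |c - Lin| ≤ (34 * u ^ 2 + 144 * u ^ 3 + 304 * u ^ 4 + 408 * u ^ 5 + 368 * u ^ 6
      + 224 * u ^ 7 + 88 * u ^ 8 + 20 * u ^ 9 + 2 * u ^ 10) * Pi := by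
    have e : (34 * u ^ 2 + 144 * u ^ 3 + 304 * u ^ 4 + 408 * u ^ 5 + 368 * u ^ 6
        + 224 * u ^ 7 + 88 * u ^ 8 + 20 * u ^ 9 + 2 * u ^ 10) * Pi
        = ((26 * u ^ 2 + 88 * u ^ 3 + 134 * u ^ 4 + 116 * u ^ 5 + 58 * u ^ 6 + 16 * u ^ 7
          + 2 * u ^ 8) + (2 * u + u ^ 2) * (4 * u + 26 * u ^ 2 + 72 * u ^ 3 + 110 * u ^ 4
          + 100 * u ^ 5 + 54 * u ^ 6 + 16 * u ^ 7 + 2 * u ^ 8))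
          * (La * (|P₁| + |P₂|) + Lb * (|P₃| + |P₄|) + Lc * (|P₅| + |P₆|)) := by
      rw [hPi]; ring
    linarith only [eL, e]
  have mL' : |c| ≤ (1 + u) ^ 2 * (4 * u + 26 * u ^ 2 + 72 * u ^ 3 + 110 * u ^ 4 + 100 * u ^ 5
      + 54 * u ^ 6 + 16 * u ^ 7 + 2 * u ^ 8) * Pi := by
    rw [hPi]; exact mL
  have hLle : |Lin| ≤ ((1 + u) ^ 2 * (4 * u + 26 * u ^ 2 + 72 * u ^ 3 + 110 * u ^ 4
      + 100 * u ^ 5 + 54 * u ^ 6 + 16 * u ^ 7 + 2 * u ^ 8) + (34 * u ^ 2 + 144 * u ^ 3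
      + 304 * u ^ 4 + 408 * u ^ 5 + 368 * u ^ 6 + 224 * u ^ 7 + 88 * u ^ 8 + 20 * u ^ 9
      + 2 * u ^ 10)) * Pi := by
    have h1 : |Lin| - |c| ≤ |Lin - c| := abs_sub_abs_le_abs_sub Lin c
    rw [abs_sub_comm] at h1
    linarith only [h1, mL', eL']
  -- the total error
  have hX : |dC - T| ≤ u * |dC| + δ * |B| + (40 * u ^ 2 + 166 * u ^ 3 + 335 * u ^ 4
      + 429 * u ^ 5 + 375 * u ^ 6 + 225 * u ^ 7 + 88 * u ^ 8 + 20 * u ^ 9 + 2 * u ^ 10)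
      * Pi := by
    have key : dC - T = (dC - (dB + c)) + (dB - B) + (c - Lin) - (T - B - Lin) := by ring
    rw [key]
    have a1 := abs_sub ((dC - (dB + c)) + (dB - B) + (c - Lin)) (T - B - Lin)
    have a2 := abs_add_le ((dC - (dB + c)) + (dB - B)) (c - Lin)
    have a3 := abs_add_le (dC - (dB + c)) (dB - B)
    have e : (40 * u ^ 2 + 166 * u ^ 3 + 335 * u ^ 4 + 429 * u ^ 5 + 375 * u ^ 6 + 225 * u ^ 7
        + 88 * u ^ 8 + 20 * u ^ 9 + 2 * u ^ 10) * Pi = (34 * u ^ 2 + 144 * u ^ 3 + 304 * u ^ 4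
        + 408 * u ^ 5 + 368 * u ^ 6 + 224 * u ^ 7 + 88 * u ^ 8 + 20 * u ^ 9 + 2 * u ^ 10) * Pi
        + (6 * u ^ 2 + 4 * u ^ 3 + u ^ 4) * (1 + u) ^ 3 * Pi := by
      ring
    linarith only [a1, a2, a3, hdC, hdB, eL', hRle, e]
  by_cases hPi00 : Pi = 0
  · -- degenerate: everything vanishes
    rw [hPi00, mul_zero] at hBle hLle hRle mL'
    have hB0 : B = 0 := abs_eq_zero.mp (le_antisymm hBle (abs_nonneg _))
    have hL0 : Lin = 0 := abs_eq_zero.mp (le_antisymm hLle (abs_nonneg _))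
    have hR0 : T - B - Lin = 0 := abs_eq_zero.mp (le_antisymm hRle (abs_nonneg _))
    have hT0 : T = 0 := by linarith only [hB0, hL0, hR0]
    have hdB0 : dB = 0 := by
      rw [hB0, sub_zero, abs_zero, mul_zero] at hdB
      exact abs_eq_zero.mp (le_antisymm hdB (abs_nonneg _))
    have hc0 : c = 0 := abs_eq_zero.mp (le_antisymm mL' (abs_nonneg _))
    have hdC0 : dC = 0 := by
      rw [hdB0, hc0, add_zero, sub_zero] at hdC
      have h2 : |dC| ≤ 0 := by
        by_contra h3
        have h4 := mul_pos h1u (not_le.mp h3)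
        linarith only [hdC, h4]
      exact abs_eq_zero.mp (le_antisymm h2 (abs_nonneg _))
    rw [hdC0, hT0]
    exact ⟨Iff.rfl, Iff.rfl⟩
  · have hPipos : 0 < Pi := lt_of_le_of_ne hPi0 (Ne.symm hPi00)
    have sC := mul_lt_mul_of_pos_right hmarginC hPipos
    have mR : δ * |B| ≤ (1 - u) ^ 3 * KR * |dB| := by
      have m1 := mul_le_mul_of_nonneg_right hmarginR.le (abs_nonneg B)
      have m2 : (1 - δ) * |B| ≤ |dB| := by
        have h1 : |B| - |dB| ≤ |B - dB| := abs_sub_abs_le_abs_sub B dB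
        rw [abs_sub_comm] at h1
        linarith only [h1, hdB]
      have m3 := mul_le_mul_of_nonneg_left m2 (le_of_lt (mul_pos (pow_pos h1u 3) hKR))
      linarith only [m1, m3]
    have t1 := mul_le_mul_of_nonneg_left (hEge.trans htest) h1u.le
    have key : |dC - T| < |dC| := by linarith only [hX, sC, mR, t1]
    exact sign_iff_of_abs_sub_lt' key

end Summit.Ventures.CertifiedArithmetic.Expansions
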